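import Mathlib
import Summits.Ventures.Crystal3D.Theorems.StickyWulffConstantTextureBuildTentCover
import Summits.Ventures.Crystal3D.Theorems.StickyWulffConstantTextureLiminfTentBarlowBonds
import HarnessLib

/-!
# Brick (T0), heights: the affine height function of a bilayer motion (lane T, stmt-Ventures-23912)

HONEST FRAMING. Venture `Summits/Ventures/Crystal3D` (cell `crystal3d-full`), route `route-Ventures-StickyWulffConstant`,
helper `--supports` the law-v5 crux `TextureLiminfV5` (stmt-Ventures-23912), towards the registered stub
`stub_T0cover : BarlowFreeCertificateCover` (`…TextureBuildTentCoverHolds.lean`).  Small facts about the frame heights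
`height L s` and the bilayer motions of `exists_bilayerMotion`:
* `height_motion_eq` — the height of a bilayer motion is AFFINE in the cubic `(111)` coordinate:
  `height (T z + c) = layerHeight i sw 0 + ½⟪(1,1,1), √2 z⟫ (layerHeight i sw 1 − layerHeight i sw 0)`, from its values
  at the four sites `0, e₀, e₁, e₂` (hence `inner_symm_eq_of_height_eq`: a point of height `m h` pulls back to the cubic
  layer plane `ℓ` with `layerHeight i sw ℓ = m h`; `exists_cubicLayer`, `layerHeight_injective`);
* `mem_layerPlane_iff`, `height_add_smul`, `continuous_height` — layer planes are height level sets, the height grows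
  by `τ` along `τ L e₃`, and is continuous.
WHAT THIS IS NOT: the certificate; F-C1 not moved.
-/

noncomputable section

open scoped BigOperators InnerProductSpace ENNReal
open MeasureTheory Filter

namespace Summit.Ventures.Crystal3D.Cruxes.TextureLiminf.TexShadow

open Summit.Ventures.Crystal3D Summit.Ventures.Crystal3D.TentCertificate
open Literature.Geometry.DiscreteGeometry (intVec)

/-! ## The height function of a bilayer motion -/

/-- **The height of a bilayer motion is affine along the cubic `(111)` coordinate**: if the motion sends the
cubic sites of layers `0, 1` to the heights `layerHeight i sw 0, layerHeight i sw 1`, then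
`height (T z + c) = layerHeight i sw 0 + ½⟪(1,1,1), √2 z⟫ · (layerHeight i sw 1 − layerHeight i sw 0)` for EVERY `z`. -/
theorem height_motion_eq (L T : E3 ≃ₗᵢ[ℝ] E3) (s c : E3) (i : ℤ) (sw : Bool)
    (hht : ∀ a : Site, (lay a = 0 ∨ lay a = 1) → height L s (T (site a) + c) = layerHeight i sw (lay a)) (z : E3) :
    height L s (T z + c) = layerHeight i sw 0 +
      (⟪intVec (normal4 0), Real.sqrt 2 • z⟫_ℝ / 2) * (layerHeight i sw 1 - layerHeight i sw 0) := by
  have hlin : ∀ z : E3, height L s (T z + c) = (L.symm (T z)) 2 + height L s (T 0 + c) := by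
    intro z
    simp only [height, map_zero, zero_add]
    have : T z + c - s = T z + (c - s) := by abel
    rw [this, map_add, PiLp.add_apply]
  have h0 : height L s (T 0 + c) = layerHeight i sw 0 := by
    have h := hht 0 (Or.inl (by simp [lay]))
    rwa [site_zero, show lay (0 : Site) = 0 by simp [lay]] at h
  have hk : ∀ a : Site, lay a = 1 → (L.symm (T (site a))) 2 = layerHeight i sw 1 - layerHeight i sw 0 := by
    intro a ha
    have h1 := hht a (Or.inr ha)
    rw [hlin, h0, ha] at h1
    linarith
  have hk1 := hk (tetUpV 1) (by decide)
  have hk2 := hk (tetUpV 2) (by decide)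
  have hk3 := hk (tetUpV 3) (by decide)
  have hs : (0 : ℝ) < Real.sqrt 2 := by positivity
  set μ₁ : ℝ := (Real.sqrt 2 * z 0 + Real.sqrt 2 * z 1 - Real.sqrt 2 * z 2) / 2 with hμ₁
  set μ₂ : ℝ := (Real.sqrt 2 * z 0 - Real.sqrt 2 * z 1 + Real.sqrt 2 * z 2) / 2 with hμ₂
  set μ₃ : ℝ := (-(Real.sqrt 2 * z 0) + Real.sqrt 2 * z 1 + Real.sqrt 2 * z 2) / 2 with hμ₃
  have hz : z = μ₁ • site (tetUpV 1) + μ₂ • site (tetUpV 2) + μ₃ • site (tetUpV 3) := by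
    ext l
    fin_cases l <;> simp [site_apply, fccPoint, tetUpV, hμ₁, hμ₂, hμ₃] <;> field_simp <;> ring
  have hsum : μ₁ + μ₂ + μ₃ = ⟪intVec (normal4 0), Real.sqrt 2 • z⟫_ℝ / 2 := by
    rw [inner_intVec_left]
    simp only [normal4, PiLp.smul_apply, smul_eq_mul, Matrix.cons_val_zero, Matrix.cons_val_one, Matrix.cons_val,
      Int.cast_one, one_mul, hμ₁, hμ₂, hμ₃]
    ring
  rw [hlin z, h0, ← hsum]
  conv_lhs => rw [hz]
  simp only [map_add, LinearIsometryEquiv.map_smul, PiLp.add_apply, PiLp.smul_apply, smul_eq_mul, hk1, hk2, hk3]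
  ring

/-- Every boundary plane `m ∈ {i, i+1}` of the slab `i` is the image of a cubic layer `ℓ ∈ {0, 1}`. -/
theorem exists_cubicLayer (i : ℤ) (sw : Bool) {m : ℤ} (hm : m = i ∨ m = i + 1) :
    ∃ ℓ : ℤ, (ℓ = 0 ∨ ℓ = 1) ∧ layerHeight i sw ℓ = m * hB := by
  rcases hm with rfl | rfl <;> cases sw
  · exact ⟨0, Or.inl rfl, by simp [layerHeight]⟩
  · exact ⟨1, Or.inr rfl, by simp [layerHeight]⟩
  · exact ⟨1, Or.inr rfl, by simp [layerHeight]⟩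
  · exact ⟨0, Or.inl rfl, by simp [layerHeight]⟩

/-- **Which cubic plane a point of given height pulls back to.** -/
theorem inner_symm_eq_of_height_eq {L T : E3 ≃ₗᵢ[ℝ] E3} {s c : E3} {i : ℤ} {sw : Bool}
    (hht : ∀ a : Site, (lay a = 0 ∨ lay a = 1) → height L s (T (site a) + c) = layerHeight i sw (lay a))
    {y : E3} {m ℓ : ℤ} (hy : height L s y = m * hB) (hℓ : layerHeight i sw ℓ = m * hB) :
    ⟪intVec (normal4 0), Real.sqrt 2 • T.symm (y - c)⟫_ℝ = 2 * ℓ := by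
  have h := height_motion_eq L T s c i sw hht (T.symm (y - c))
  rw [LinearIsometryEquiv.apply_symm_apply, sub_add_cancel, hy] at h
  have hh := hB_pos
  set f := ⟪intVec (normal4 0), Real.sqrt 2 • T.symm (y - c)⟫_ℝ with hf
  cases sw
  · simp only [layerHeight, Bool.false_eq_true, if_false, Int.cast_zero, Int.cast_one] at h hℓ
    have e1 : ((ℓ : ℝ) - (m - i)) * hB = 0 := by linarith
    have e2 : (f / 2 - (m - i)) * hB = 0 := by nlinarith
    rcases mul_eq_zero.1 e1 with e1 | e1
    · rcases mul_eq_zero.1 e2 with e2 | e2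
      · linarith
      · exact absurd e2 hh.ne'
    · exact absurd e1 hh.ne'
  · simp only [layerHeight, if_true, Int.cast_zero, Int.cast_one] at h hℓ
    have e1 : ((ℓ : ℝ) - (i + 1 - m)) * hB = 0 := by linarith
    have e2 : (f / 2 - (i + 1 - m)) * hB = 0 := by nlinarith
    rcases mul_eq_zero.1 e1 with e1 | e1
    · rcases mul_eq_zero.1 e2 with e2 | e2
      · linarith
      · exact absurd e2 hh.ne'
    · exact absurd e1 hh.ne'

/-! ## Layer planes and heights -/

/-- Membership in a layer plane is a height condition. -/
theorem mem_layerPlane_iff (L : E3 ≃ₗᵢ[ℝ] E3) (s : E3) (m : ℤ) (y : E3) :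
    y ∈ layerPlane L s m ↔ height L s y = m * hB := by
  constructor
  · rintro ⟨r, hr, rfl⟩
    rw [height_move]; exact hr
  · intro h
    exact ⟨L.symm (y - s), h, move_symm L s y⟩

/-- Heights along the stacking normal `L e₃`. -/
theorem height_add_smul (L : E3 ≃ₗᵢ[ℝ] E3) (s y : E3) (τ : ℝ) :
    height L s (y + τ • L (EuclideanSpace.single 2 1)) = height L s y + τ := by
  simp only [height]
  have : y + τ • L (EuclideanSpace.single 2 1) - s = (y - s) + τ • L (EuclideanSpace.single 2 1) := by abel
  rw [this, map_add, LinearIsometryEquiv.map_smul, LinearIsometryEquiv.symm_apply_apply]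
  simp

/-- The height is continuous. -/
theorem continuous_height (L : E3 ≃ₗᵢ[ℝ] E3) (s : E3) : Continuous (height L s) := by
  unfold height
  exact (EuclideanSpace.proj (2 : Fin 3)).continuous.comp (L.symm.continuous.comp (continuous_id.sub continuous_const))

/-- `layerHeight i sw` is injective in the layer index. -/
theorem layerHeight_injective (i : ℤ) (sw : Bool) {l ℓ : ℤ} (h : layerHeight i sw l = layerHeight i sw ℓ) : l = ℓ := by
  have hh := hB_pos
  have h' : ((i : ℝ) + (if sw then 1 - (l : ℝ) else (l : ℝ))) = ((i : ℝ) + (if sw then 1 - (ℓ : ℝ) else (ℓ : ℝ))) :=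
    mul_right_cancel₀ hh.ne' h
  cases sw
  · simp only [Bool.false_eq_true, if_false] at h'
    exact_mod_cast (by linarith : (l : ℝ) = ℓ)
  · simp only [if_true] at h'
    exact_mod_cast (by linarith : (l : ℝ) = ℓ)

end Summit.Ventures.Crystal3D.Cruxes.TextureLiminf.TexShadow

end
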